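import Summits.KontsevichZagierPeriods.KontsevichZagierPeriods.Theorems.PentagonInKZ.Negative.WeightThreeShape

/-!
# `PentagonInKZ` — negative lane, §18a: the weight-4 SHAPE of `Φ_χ` in every realisation

Standing adversary (cdisprove seat, generation 3) on the crux `PentagonInKZ`
(stmt-KontsevichZagierPeriods-11348), continuing `Negative/WeightThreeShape.lean` one weight up.

With NO hypothesis on `χ` (only the linear shuffle identities `Σ_{w ∈ a ш v} Φ_χ(w) = 0` of a
letter against a three-letter word, `sum_cruxSeries_shuffle_letter`), ALL sixteen weight-4
coefficients of the crux series are explicit `ℤ`-combinations of the four convergent ones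
`α₁ = c_{xxxy} = -z₄`, `α₃₁ = c_{xxyy} = z₃₁`, `α₂₂ = c_{xyxy} = z₂₂`, `α₂₁₁ = c_{xyyy} = -z₂₁₁`
(`zₛ = χ(Z s)`): `xxxx = yyyy = 0`, `xxyx = -3α₁`, `xyxx = 3α₁`, `yxxx = -α₁`, `xyyx = -2α₃₁ - α₂₂`,
`yxxy = -α₂₂ - 2α₃₁`, `yxyx = α₂₂ + 4α₃₁`, `yyxx = -α₃₁`, `yxyy = -3α₂₁₁`, `yyxy = 3α₂₁₁`,
`yyyx = -α₂₁₁`.  Hence modulo weight 5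
`Φ_χ ≡ 1 + c[x,y] + p[x,[x,y]] + q[[x,y],y] + α₁[x,[x,[x,y]]] - α₃₁[y,[x,[x,y]]] + α₂₁₁[y,[y,[x,y]]]
  + (α₂₂ + 2α₃₁)[x,y]²`
(`evalTrunc_four_of_shape`): a Lie exponential EXCEPT for the coefficient of `[x,y]²`, which is
`α₂₂ + 2α₃₁ = z₂₂ + 2z₃₁` instead of the group-like value `c²/2 = z₂²/2` — the defect is exactly the
SHUFFLE relation `z₂² = 2z₂₂ + 4z₃₁` (a dissection; item ShuffleIsDissection at `(2),(2)`).
Used by `Negative/WeightFourTightness.lean`.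
-/

noncomputable section

open Literature.NumberTheory.Transcendental

namespace Summit.KontsevichZagierPeriods.FurushoPentagon.PentagonInKZNegative

open Summit.KontsevichZagierPeriods.KontsevichZagierPeriods.Theses.FurushoPentagon (PentagonInKZ)

/-! ## §18a The twelve regularised weight-4 coefficients -/

section CoeffFour

variable {R : Type} [CommRing R] [Algebra ℚ R] (χ : KZ.FormalRep →+ R) (Z : List ℕ → KZ.FormalRep)

/-- Division by a non-zero natural number in the target of a realisation. [folklore] -/
theorem eq_of_natCast_mul_eq {n : ℕ} (hn : n ≠ 0) {a b : R} (h : (n : R) * a = (n : R) * b) :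
    a = b := by
  have hu := NCSeries.isUnit_natCast_of_ne_zero (S := R) (n := n) hn
  have h0 : (n : R) * (a - b) = 0 := by rw [mul_sub, h, sub_self]
  exact sub_eq_zero.mp (hu.mul_right_eq_zero.mp h0)

/-- `Φ_χ(xxxx) = 0` (from `x ш xxx = 4xxxx`). [cite: IharaKanekoZagier2006, §3] -/
theorem cruxSeries_xxxx : cruxSeries R χ Z [false, false, false, false] = 0 := by
  have h := sum_cruxSeries_shuffle_letter χ Z false [false, false, false] 0 (by decide)
  have hw : MZV.shuffleWord [false] [false, false, false] = [[false, false, false, false],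
      [false, false, false, false], [false, false, false, false], [false, false, false, false]] := by
    decide
  rw [hw] at h
  simp only [List.map_cons, List.map_nil, List.sum_cons, List.sum_nil, add_zero] at h
  refine eq_of_natCast_mul_eq (n := 4) (by norm_num) ?_
  rw [mul_zero]; push_cast; linear_combination h

/-- `Φ_χ(yyyy) = 0` (from `y ш yyy = 4yyyy`). [cite: IharaKanekoZagier2006, §3] -/
theorem cruxSeries_yyyy : cruxSeries R χ Z [true, true, true, true] = 0 := by
  have h := sum_cruxSeries_shuffle_letter χ Z true [true, true, true] 4 (by decide)
  have hw : MZV.shuffleWord [true] [true, true, true] = [[true, true, true, true],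
      [true, true, true, true], [true, true, true, true], [true, true, true, true]] := by decide
  rw [hw] at h
  simp only [List.map_cons, List.map_nil, List.sum_cons, List.sum_nil, add_zero] at h
  refine eq_of_natCast_mul_eq (n := 4) (by norm_num) ?_
  rw [mul_zero]; push_cast; linear_combination h

/-- `Φ_χ(xxyx) = -3 c_{xxxy}` (from `x ш xxy = 3xxxy + xxyx`). [cite: IharaKanekoZagier2006, §3] -/
theorem cruxSeries_xxyx : cruxSeries R χ Z [false, false, true, false] =
    -3 * cruxSeries R χ Z [false, false, false, true] := by
  have h := sum_cruxSeries_shuffle_letter χ Z false [false, false, true] 1 (by decide)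
  have hw : MZV.shuffleWord [false] [false, false, true] = [[false, false, false, true],
      [false, false, false, true], [false, false, false, true], [false, false, true, false]] := by
    decide
  rw [hw] at h
  simp only [List.map_cons, List.map_nil, List.sum_cons, List.sum_nil, add_zero] at h
  linear_combination h

/-- `Φ_χ(xyxx) = 3 c_{xxxy}` (from `x ш xyx = 2xxyx + 2xyxx`). [cite: IharaKanekoZagier2006, §3] -/
theorem cruxSeries_xyxx : cruxSeries R χ Z [false, true, false, false] =
    3 * cruxSeries R χ Z [false, false, false, true] := by
  have h := sum_cruxSeries_shuffle_letter χ Z false [false, true, false] 1 (by decide)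
  have hw : MZV.shuffleWord [false] [false, true, false] = [[false, false, true, false],
      [false, false, true, false], [false, true, false, false], [false, true, false, false]] := by
    decide
  rw [hw] at h
  simp only [List.map_cons, List.map_nil, List.sum_cons, List.sum_nil, add_zero,
    cruxSeries_xxyx] at h
  refine eq_of_natCast_mul_eq (n := 2) (by norm_num) ?_
  push_cast; linear_combination h

/-- `Φ_χ(yxxx) = -c_{xxxy}` (from `x ш yxx = xyxx + 3yxxx`). [cite: IharaKanekoZagier2006, §3] -/
theorem cruxSeries_yxxx : cruxSeries R χ Z [true, false, false, false] =
    -cruxSeries R χ Z [false, false, false, true] := by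
  have h := sum_cruxSeries_shuffle_letter χ Z false [true, false, false] 1 (by decide)
  have hw : MZV.shuffleWord [false] [true, false, false] = [[false, true, false, false],
      [true, false, false, false], [true, false, false, false], [true, false, false, false]] := by
    decide
  rw [hw] at h
  simp only [List.map_cons, List.map_nil, List.sum_cons, List.sum_nil, add_zero,
    cruxSeries_xyxx] at h
  refine eq_of_natCast_mul_eq (n := 3) (by norm_num) ?_
  push_cast; linear_combination h

/-- `Φ_χ(xyyx) = -2c_{xxyy} - c_{xyxy}` (from `x ш xyy = 2xxyy + xyxy + xyyx`). [cite: IharaKanekoZagier2006, §3] -/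
theorem cruxSeries_xyyx : cruxSeries R χ Z [false, true, true, false] =
    -2 * cruxSeries R χ Z [false, false, true, true] - cruxSeries R χ Z [false, true, false, true] := by
  have h := sum_cruxSeries_shuffle_letter χ Z false [false, true, true] 2 (by decide)
  have hw : MZV.shuffleWord [false] [false, true, true] = [[false, false, true, true],
      [false, false, true, true], [false, true, false, true], [false, true, true, false]] := by
    decide
  rw [hw] at h
  simp only [List.map_cons, List.map_nil, List.sum_cons, List.sum_nil, add_zero] at h
  linear_combination h

/-- `Φ_χ(yxxy) = -c_{xyxy} - 2c_{xxyy}` (from `y ш xxy = yxxy + xyxy + 2xxyy`). [cite: IharaKanekoZagier2006, §3] -/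
theorem cruxSeries_yxxy : cruxSeries R χ Z [true, false, false, true] =
    -cruxSeries R χ Z [false, true, false, true] - 2 * cruxSeries R χ Z [false, false, true, true] := by
  have h := sum_cruxSeries_shuffle_letter χ Z true [false, false, true] 2 (by decide)
  have hw : MZV.shuffleWord [true] [false, false, true] = [[true, false, false, true],
      [false, true, false, true], [false, false, true, true], [false, false, true, true]] := by
    decide
  rw [hw] at h
  simp only [List.map_cons, List.map_nil, List.sum_cons, List.sum_nil, add_zero] at h
  linear_combination h

/-- `Φ_χ(yxyx) = c_{xyxy} + 4c_{xxyy}` (from `y ш xyx = yxyx + 2xyyx + xyxy`). [cite: IharaKanekoZagier2006, §3] -/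
theorem cruxSeries_yxyx : cruxSeries R χ Z [true, false, true, false] =
    cruxSeries R χ Z [false, true, false, true] + 4 * cruxSeries R χ Z [false, false, true, true] := by
  have h := sum_cruxSeries_shuffle_letter χ Z true [false, true, false] 2 (by decide)
  have hw : MZV.shuffleWord [true] [false, true, false] = [[true, false, true, false],
      [false, true, true, false], [false, true, true, false], [false, true, false, true]] := by
    decide
  rw [hw] at h
  simp only [List.map_cons, List.map_nil, List.sum_cons, List.sum_nil, add_zero,
    cruxSeries_xyyx] at h
  linear_combination h

/-- `Φ_χ(yyxx) = -c_{xxyy}` (from `y ш yxx = 2yyxx + yxyx + yxxy`). [cite: IharaKanekoZagier2006, §3] -/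
theorem cruxSeries_yyxx : cruxSeries R χ Z [true, true, false, false] =
    -cruxSeries R χ Z [false, false, true, true] := by
  have h := sum_cruxSeries_shuffle_letter χ Z true [true, false, false] 2 (by decide)
  have hw : MZV.shuffleWord [true] [true, false, false] = [[true, true, false, false],
      [true, true, false, false], [true, false, true, false], [true, false, false, true]] := by
    decide
  rw [hw] at h
  simp only [List.map_cons, List.map_nil, List.sum_cons, List.sum_nil, add_zero,
    cruxSeries_yxyx, cruxSeries_yxxy] at h
  refine eq_of_natCast_mul_eq (n := 2) (by norm_num) ?_
  push_cast; linear_combination h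

/-- `Φ_χ(yxyy) = -3 c_{xyyy}` (from `y ш xyy = yxyy + 3xyyy`). [cite: IharaKanekoZagier2006, §3] -/
theorem cruxSeries_yxyy : cruxSeries R χ Z [true, false, true, true] =
    -3 * cruxSeries R χ Z [false, true, true, true] := by
  have h := sum_cruxSeries_shuffle_letter χ Z true [false, true, true] 3 (by decide)
  have hw : MZV.shuffleWord [true] [false, true, true] = [[true, false, true, true],
      [false, true, true, true], [false, true, true, true], [false, true, true, true]] := by
    decide
  rw [hw] at h
  simp only [List.map_cons, List.map_nil, List.sum_cons, List.sum_nil, add_zero] at h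
  linear_combination h

/-- `Φ_χ(yyxy) = 3 c_{xyyy}` (from `y ш yxy = 2yyxy + 2yxyy`). [cite: IharaKanekoZagier2006, §3] -/
theorem cruxSeries_yyxy : cruxSeries R χ Z [true, true, false, true] =
    3 * cruxSeries R χ Z [false, true, true, true] := by
  have h := sum_cruxSeries_shuffle_letter χ Z true [true, false, true] 3 (by decide)
  have hw : MZV.shuffleWord [true] [true, false, true] = [[true, true, false, true],
      [true, true, false, true], [true, false, true, true], [true, false, true, true]] := by
    decide
  rw [hw] at h
  simp only [List.map_cons, List.map_nil, List.sum_cons, List.sum_nil, add_zero,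
    cruxSeries_yxyy] at h
  refine eq_of_natCast_mul_eq (n := 2) (by norm_num) ?_
  push_cast; linear_combination h

/-- `Φ_χ(yyyx) = -c_{xyyy}` (from `y ш yyx = 3yyyx + yyxy`). [cite: IharaKanekoZagier2006, §3] -/
theorem cruxSeries_yyyx : cruxSeries R χ Z [true, true, true, false] =
    -cruxSeries R χ Z [false, true, true, true] := by
  have h := sum_cruxSeries_shuffle_letter χ Z true [true, true, false] 3 (by decide)
  have hw : MZV.shuffleWord [true] [true, true, false] = [[true, true, true, false],
      [true, true, true, false], [true, true, true, false], [true, true, false, true]] := by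
    decide
  rw [hw] at h
  simp only [List.map_cons, List.map_nil, List.sum_cons, List.sum_nil, add_zero,
    cruxSeries_yyxy] at h
  refine eq_of_natCast_mul_eq (n := 3) (by norm_num) ?_
  push_cast; linear_combination h

end CoeffFour

/-! ## §18b `φ(a,b)` in weight `≤ 4` for a series of the regularised shape -/

section ShapeFour

variable {k : Type} [CommRing k]

/-- **`φ(a,b)` in weight `≤ 4`** for a series whose sixteen weight-4 coefficients follow the
regularised pattern of §18a (and the Lie shape in weight `≤ 3`):
`φ(a,b) = [weight ≤ 3] + α₁[a,[a,[a,b]]] + α₃₁(aabb - 2abba - 2baab + 4baba - bbaa)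
  + α₂₂[a,b]² + α₂₁₁[[[a,b],b],b]`. [folklore] -/
theorem evalTrunc_four_of_shape {φ : NCSeries Bool k}
    (hffff : φ [false, false, false, false] = 0) (htttt : φ [true, true, true, true] = 0)
    (hfftf : φ [false, false, true, false] = -3 * φ [false, false, false, true])
    (hftff : φ [false, true, false, false] = 3 * φ [false, false, false, true])
    (htfff : φ [true, false, false, false] = -φ [false, false, false, true])
    (hfttf : φ [false, true, true, false] =
      -2 * φ [false, false, true, true] - φ [false, true, false, true])
    (htfft : φ [true, false, false, true] =
      -φ [false, true, false, true] - 2 * φ [false, false, true, true])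
    (htftf : φ [true, false, true, false] =
      φ [false, true, false, true] + 4 * φ [false, false, true, true])
    (httff : φ [true, true, false, false] = -φ [false, false, true, true])
    (htftt : φ [true, false, true, true] = -3 * φ [false, true, true, true])
    (httft : φ [true, true, false, true] = 3 * φ [false, true, true, true])
    (htttf : φ [true, true, true, false] = -φ [false, true, true, true])
    {A : Type} [Ring A] [Algebra k A] (a b : A) :
    NCSeries.evalTrunc 4 (NCSeries.bsub a b) φ = NCSeries.evalTrunc 3 (NCSeries.bsub a b) φ +
      φ [false, false, false, true] •
        (a * a * a * b - (3 : k) • (a * a * b * a) + (3 : k) • (a * b * a * a) - b * a * a * a) +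
      φ [false, false, true, true] •
        (a * a * b * b - (2 : k) • (a * b * b * a) - (2 : k) • (b * a * a * b) +
          (4 : k) • (b * a * b * a) - b * b * a * a) +
      φ [false, true, false, true] • (a * b * a * b - a * b * b * a - b * a * a * b + b * a * b * a) +
      φ [false, true, true, true] •
        (a * b * b * b - (3 : k) • (b * a * b * b) + (3 : k) • (b * b * a * b) - b * b * b * a) := by
  rw [NCSeries.evalTrunc_four_eq]
  simp only [Fintype.sum_bool, NCSeries.bsub_false, NCSeries.bsub_true, hffff, htttt, hfftf, hftff,
    htfff, hfttf, htfft, htftf, httff, htftt, httft, htttf, zero_smul, add_zero, zero_add]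
  module

end ShapeFour

/-! ## §18c The scaling endomorphisms `t_ij ↦ c · t_ij` of `U𝔞 ⊗ R/(deg > N)` -/

section Scale

open DrinfeldKohnoTrunc

variable {R : Type} [CommRing R] {ι : Type} {N : ℕ}

/-- Products of rescaled elements: `∏ (c · xᵢ) = c^{|L|} · ∏ xᵢ`. [folklore] -/
theorem prod_map_smul (c : R) : ∀ L : List (DrinfeldKohnoTrunc R ι N),
    (L.map fun x => c • x).prod = c ^ L.length • L.prod
  | [] => by simp
  | x :: L => by
    rw [List.map_cons, List.prod_cons, List.prod_cons, prod_map_smul c L, List.length_cons,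
      pow_succ, smul_mul_assoc, mul_smul_comm, smul_smul, mul_comm]

variable (R ι N) in
/-- **The scaling endomorphism** `σ_c : t_ij ↦ c · t_ij` of the truncated Drinfeld–Kohno algebra
(all defining relations are homogeneous). [folklore] -/
theorem exists_scaleHom (c : R) :
    ∃ σ : DrinfeldKohnoTrunc R ι N →ₐ[R] DrinfeldKohnoTrunc R ι N, ∀ i j, σ (t R N i j) = c • t R N i j := by
  classical
  refine ⟨RingQuot.liftAlgHom R ⟨FreeAlgebra.lift R (fun p : ι × ι => c • t R N p.1 p.2),
    fun a b hab => ?_⟩, fun i j => ?_⟩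
  · cases hab with
    | diag i => simp
    | symm i j => simp [t_symm i j]
    | fourTerm i j k hij hjk hik =>
      simp only [map_mul, map_add, FreeAlgebra.lift_ι_apply, ← smul_add, smul_mul_assoc,
        mul_smul_comm]
      rw [t_mul_add i j k hij hjk hik]
    | locality i j k l hij hik hil hjk hjl hkl =>
      simp only [map_mul, FreeAlgebra.lift_ι_apply, smul_mul_assoc, mul_smul_comm]
      rw [t_comm i j k l hij hik hil hjk hjl hkl]
    | trunc g =>
      rw [map_list_prod, map_zero, List.map_ofFn]
      have h : (List.ofFn ((fun x => c • x) ∘ fun r => t R N (g r).1 (g r).2)).prod = 0 := by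
        rw [← List.map_ofFn, prod_map_smul, prod_t_eq_zero, smul_zero]
      simpa [Function.comp_def] using h
  · exact (RingQuot.liftAlgHom_mkAlgHom_apply R _ _ _).trans (FreeAlgebra.lift_ι_apply _ _)

end Scale

end Summit.KontsevichZagierPeriods.FurushoPentagon.PentagonInKZNegative
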